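import Summits.CriticalPhenomena.PercolationContinuityZ3.Theorems.PercNearOneGluingNoHeavyLowerTailIncStarBridgeEvents
import Summits.CriticalPhenomena.PercolationContinuityZ3.Theorems.PercNearOneGluingAdditiveGluingTieLiftOne
import Literature.Probability.Percolation.BergKahnLogSupermodular
import Literature.Probability.Percolation.ShorteningInfluenceBound
import HarnessLib

/-!
# THEOREM B: the increasing star lies above its chords along every 1|2 environment bridge (all graphs)

Support file for the Sahi programme (`--supports stmt-CriticalPhenomena-4575`, prover prim-sahi-p2 gen 19).  No definitions, no named
facts, no sorries; standard axioms.  Memo `run/shared/lean/prim/prim-sahi/prim-sahi-p2/gen18/THEOREM-B-C.md` (Theorem B), `PROOF-E3.md` §28m;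
this is part II of the EVENT LAYER left at paper level by gen 18 (part I: `…IncStarBridgeEvents`; algebraic core `IncStar.bridgeConcavity_core`).

**Setting.**  Product Bernoulli bond percolation `prodBernoulli w` on all pairs of `Fin n`; a root `s` and targets `a, b, c`; the increasing star
`E₃ = sahiE3 P_w {s↔a} {s↔b} {s↔c}`.  A vertex set `L ∌ s` (the NEAR side) with `a, u ∈ L`, and `v, b, c ∉ L` (the FAR side `R = (L ∪ {s})ᶜ`,
root pairs into either side arbitrary), such that every pair `{x,y}` with `x ∈ L`, `y ∉ L ∪ {s}` other than `e = s(u,v)` has weight `0` — `e` is an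
ENVIRONMENT BRIDGE (a bridge of `G − s`, or absent) separating ONE target from the other two.

**Theorem `incStar_bridge_chord` (Theorem B, chord form, every finite graph).**
`(1 − w e)·E₃(w[e↦0]) + (w e)·E₃(w[e↦1]) ≤ E₃(w)`.

**Proof (formalised here).**  (1) One-bond decomposition: every moment is affine in `w e` (`prodBernoulli_real_oneBond`).  (2) Under `w[e↦0]` the
root is a cut vertex between `L ∪ {s}` and `R ∪ {s}`: almost surely `{s↔a} = {s↔a in L∪{s}} =: T`, `{s↔b} = {s↔b in R∪{s}} =: B⁰` (cut-vertex
lemmas of `…IncStarCutVertex`), and events inside the two sides are independent (disjoint coordinates, `prodBernoulli_real_inter_of_determinedBy`).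
(3) Under `w[e↦1] = P_{w[e↦0]} ∘ (insert e)⁻¹` (`tieLiftOne_real_one_eq`) the lifted events are, almost surely,
`{s↔a} = T ∪ (P′ ∩ F)`, `{s↔b} = B⁰ ∪ (S ∩ R_b)` with `F = {u↔a in L∪{s}}`, `S = {s↔u in L∪{s}}`, `P′ = {s↔v in R∪{s}}`, `R_b = {v↔b in R∪{s}}`
(part I, `bridge_lift_near/_far`).  (4) Hence the seven slopes have the product form of `IncStar.bridgeConcavity_chord` with `τ = P(T)`,
`σ = P(S)`, `σ′ = P(P′)`, `α = P(F∖T)`, `γ = P(F∩T)`, `γ+K = P(T∩S)`, `d_b = P(R_b∖B⁰)`, `ξ_b = P((R_b∖B⁰)∩C⁰)`, `y_b = P(P′∩B⁰)`, … .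
(5) The four classical inequalities: (H1) Harris for `P′, B⁰` and `P′, C⁰`; (H2) Harris for `T, S`;
(H4) Harris for `S, F` together with `S ∩ F = T ∩ F`; (H3) van den Berg–Kahn 2001 Thm 1.1 (`BergKahn.bergKahn_thm_1_1`, tree) at the vertex `v`
with the avoided vertex `s`: `d_b d_c ≤ d_bc·P(v↛s) ≤ d_bc`.  (6) The chord inequality is then the polynomial identity
`E₃(p) − [(1−p)E₃(0) + pE₃(1)] = p(1−p)(σ·W + δ_aδ_bδ_c(2−p))` with `W ≥ 0` = `IncStar.bridgeConcavity_core` (part I, `bridgeChord_poly`).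
Consequence (Theorem C): with the blob reduction and `IncStar.incStar_nonneg_of_nonRootDet`, the increasing star holds on every graph whose
environment `G − s` is a forest (`…IncStarApexForestSchema`, `…IncStarApexForest`).
-/

noncomputable section

namespace Summit.CriticalPhenomena.PercolationContinuityZ3.Theorems

namespace IncStar

open MeasureTheory Set Literature.Probability.Percolation Literature.Probability.LatticeModels EdgeInduction
open Literature.Probability.Percolation.BlockExploration (mem_openConn_iff_openConnIn_univ)
open scoped Classical

variable {n : ℕ}

/-- **THEOREM B (bridge concavity of the increasing star, chord form; every finite graph).**  Let `L ∌ s` contain `a` and `u` but none of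
`v, b, c`, and let every pair from `L` to `(L ∪ {s})ᶜ` other than `e = s(u,v)` have weight `0` (an environment bridge separating one target
from the other two; root pairs arbitrary on both sides).  Then Sahi's cubic of the increasing star lies above its chord along `e`:
`(1 − w e)·E₃(w[e↦0]) + (w e)·E₃(w[e↦1]) ≤ E₃(w)`.  Ingredients: Harris ×3, van den Berg–Kahn 2001 Thm 1.1, and `bridgeConcavity_core`.
[this work] -/
theorem incStar_bridge_chord (w : Sym2 (Fin n) → unitInterval) (L : Set (Fin n)) {s u v a b c : Fin n}
    (hsL : s ∉ L) (huL : u ∈ L) (hvL : v ∉ L) (haL : a ∈ L) (hbL : b ∉ L) (hcL : c ∉ L)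
    (hcross : ∀ x y : Fin n, x ∈ L → y ∉ L → y ≠ s → s(x, y) ≠ s(u, v) → w s(x, y) = 0) :
    (1 - (w s(u, v) : ℝ)) *
        sahiE3 (prodBernoulli (Function.update w s(u, v) 0)) (openConn s a) (openConn s b) (openConn s c)
      + (w s(u, v) : ℝ) *
        sahiE3 (prodBernoulli (Function.update w s(u, v) 1)) (openConn s a) (openConn s b) (openConn s c)
    ≤ sahiE3 (prodBernoulli w) (openConn s a) (openConn s b) (openConn s c) := by
  -- names
  set e : Sym2 (Fin n) := s(u, v)
  set w0 := Function.update w e 0 with hw0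
  set w1 := Function.update w e 1
  have hs1 : s ∈ insert s L := Set.mem_insert s L
  have ha1 : a ∈ insert s L := Set.mem_insert_of_mem s haL
  -- the events
  set T : Set (BondConfig (Fin n)) := openConnIn (insert s L) s a
  set S : Set (BondConfig (Fin n)) := openConnIn (insert s L) s u
  set F : Set (BondConfig (Fin n)) := openConnIn (insert s L) u a
  set P' : Set (BondConfig (Fin n)) := openConnIn Lᶜ s v
  set B0 : Set (BondConfig (Fin n)) := openConnIn Lᶜ s b
  set C0 : Set (BondConfig (Fin n)) := openConnIn Lᶜ s c
  -- (0) the bridge hypothesis under `w0`, and the almost-sure set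
  have hw0cross : ∀ x y : Fin n, x ∈ L → y ∉ L → y ≠ s → w0 s(x, y) = 0 := by
    intro x y hx hy hys
    by_cases hxy : s(x, y) = e
    · rw [hxy, hw0, Function.update_self]
    · rw [hw0, Function.update_of_ne hxy]; exact hcross x y hx hy hys hxy
  set G : Set (BondConfig (Fin n)) := {ω | ∀ e', w0 e' = 0 → e' ∉ ω}
  have hG1 : (prodBernoulli w0).real G = 1 := real_sureClosed w0
  have hωG : ∀ ω ∈ G, ∀ x y : Fin n, x ∈ L → y ∉ L → y ≠ s → s(x, y) ∉ ω :=
    fun ω hω x y hx hy hys => hω _ (hw0cross x y hx hy hys)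
  have hm : ∀ X : Set (BondConfig (Fin n)), MeasurableSet X := fun _ => MeasurableSet.of_discrete
  -- (1) coordinates: off-diagonal pairs inside the near block; independence of the two blocks
  set K : Finset (Sym2 (Fin n)) := Finset.univ.filter fun z : Sym2 (Fin n) => ¬ z.IsDiag ∧ ∀ x ∈ z, x ∈ insert s L with hK
  have hKcoe : (↑K : Set (Sym2 (Fin n))) = {z : Sym2 (Fin n) | ¬ z.IsDiag ∧ ∀ x ∈ z, x ∈ insert s L} := by
    ext z; simp [hK]
  have hdet₁ : ∀ x y : Fin n, DeterminedBy (openConnIn (insert s L) x y : Set (BondConfig (Fin n))) (↑K : Set (Sym2 (Fin n))) := by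
    intro x y; rw [hKcoe]; exact IncStarCutVertex.determinedBy_openConnIn_offDiag _ x y
  have hdet₂ : ∀ x y : Fin n, DeterminedBy (openConnIn Lᶜ x y : Set (BondConfig (Fin n))) (↑K : Set (Sym2 (Fin n)))ᶜ := by
    intro x y
    refine (IncStarCutVertex.determinedBy_openConnIn_offDiag Lᶜ x y).mono fun z hz hzK => ?_
    rw [hKcoe] at hzK
    obtain ⟨hnd, hz₂⟩ := hz
    obtain ⟨-, hz₁⟩ := hzK
    revert hnd hz₁ hz₂
    refine Sym2.inductionOn z fun p q => ?_
    intro hnd hz₂ hz₁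
    have hp : p = s := bridge_cv_hV L s p (hz₁ p (Sym2.mem_mk_left p q)) (hz₂ p (Sym2.mem_mk_left p q))
    have hq : q = s := bridge_cv_hV L s q (hz₁ q (Sym2.mem_mk_right p q)) (hz₂ q (Sym2.mem_mk_right p q))
    exact hnd (by rw [Sym2.mk_isDiag_iff, hp, hq])
  have hdiff : ∀ {A B : Set (BondConfig (Fin n))} {K' : Set (Sym2 (Fin n))},
      DeterminedBy A K' → DeterminedBy B K' → DeterminedBy (A \ B) K' := by
    intro A B K' hA hB
    rw [determinedBy_iff] at hA hB ⊢
    intro ω ω' h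
    rw [Set.mem_sdiff, Set.mem_sdiff, hA ω ω' h, hB ω ω' h]
  have indep : ∀ {A B : Set (BondConfig (Fin n))}, DeterminedBy A (↑K : Set (Sym2 (Fin n))) →
      DeterminedBy B (↑K : Set (Sym2 (Fin n)))ᶜ → (prodBernoulli w0).real (A ∩ B) = (prodBernoulli w0).real A * (prodBernoulli w0).real B :=
    fun hA hB => prodBernoulli_real_inter_of_determinedBy w0 K hA hB (hm _) (hm _)
  have hdT : DeterminedBy T (↑K : Set (Sym2 (Fin n))) := hdet₁ s a
  have hdS : DeterminedBy S (↑K : Set (Sym2 (Fin n))) := hdet₁ s u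
  have hdF : DeterminedBy F (↑K : Set (Sym2 (Fin n))) := hdet₁ u a
  have hdP' : DeterminedBy P' (↑K : Set (Sym2 (Fin n)))ᶜ := hdet₂ s v
  have hdB0 : DeterminedBy B0 (↑K : Set (Sym2 (Fin n)))ᶜ := hdet₂ s b
  have hdC0 : DeterminedBy C0 (↑K : Set (Sym2 (Fin n)))ᶜ := hdet₂ s c
  have hdRb : DeterminedBy (openConnIn Lᶜ v b \ B0) (↑K : Set (Sym2 (Fin n)))ᶜ := hdiff (hdet₂ v b) hdB0
  have hdRc : DeterminedBy (openConnIn Lᶜ v c \ C0) (↑K : Set (Sym2 (Fin n)))ᶜ := hdiff (hdet₂ v c) hdC0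
  -- (2) elementary relations between the events
  have hSF_T : ∀ ω, ω ∈ S → ω ∈ F → ω ∈ T := fun ω hS' hF' => PlanarDuality.openConnIn_trans hS' hF'
  have hFT_S : ∀ ω, ω ∈ F → ω ∈ T → ω ∈ S := fun ω hF' hT' => PlanarDuality.openConnIn_trans hT' (openConnIn_symm' hF')
  -- (3) the moments under `w0`
  have m0a : (prodBernoulli w0).real (openConn s a) = (prodBernoulli w0).real T :=
    real_congr_of_sure hG1 fun ω hω => bridge_conn_ll L hsL (hωG ω hω) hs1 ha1
  have m0b : (prodBernoulli w0).real (openConn s b) = (prodBernoulli w0).real B0 :=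
    real_congr_of_sure hG1 fun ω hω => by
      rw [bridge_conn_lr L hsL (hωG ω hω) hs1 hbL]
      exact ⟨fun h => h.2, fun h => ⟨⟨hs1, hs1, SimpleGraph.Reachable.refl _⟩, h⟩⟩
  have m0c : (prodBernoulli w0).real (openConn s c) = (prodBernoulli w0).real C0 :=
    real_congr_of_sure hG1 fun ω hω => by
      rw [bridge_conn_lr L hsL (hωG ω hω) hs1 hcL]
      exact ⟨fun h => h.2, fun h => ⟨⟨hs1, hs1, SimpleGraph.Reachable.refl _⟩, h⟩⟩
  have m0ab : (prodBernoulli w0).real (openConn s a ∩ openConn s b) = (prodBernoulli w0).real T * (prodBernoulli w0).real B0 := by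
    rw [← indep hdT hdB0]
    refine real_congr_of_sure hG1 fun ω hω => ?_
    simp only [Set.mem_inter_iff]
    rw [bridge_conn_ll L hsL (hωG ω hω) hs1 ha1, bridge_conn_lr L hsL (hωG ω hω) hs1 hbL]
    exact ⟨fun h => ⟨h.1, h.2.2⟩, fun h => ⟨h.1, ⟨hs1, hs1, SimpleGraph.Reachable.refl _⟩, h.2⟩⟩
  have m0ac : (prodBernoulli w0).real (openConn s a ∩ openConn s c) = (prodBernoulli w0).real T * (prodBernoulli w0).real C0 := by
    rw [← indep hdT hdC0]
    refine real_congr_of_sure hG1 fun ω hω => ?_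
    simp only [Set.mem_inter_iff]
    rw [bridge_conn_ll L hsL (hωG ω hω) hs1 ha1, bridge_conn_lr L hsL (hωG ω hω) hs1 hcL]
    exact ⟨fun h => ⟨h.1, h.2.2⟩, fun h => ⟨h.1, ⟨hs1, hs1, SimpleGraph.Reachable.refl _⟩, h.2⟩⟩
  have m0bc : (prodBernoulli w0).real (openConn s b ∩ openConn s c) = (prodBernoulli w0).real (B0 ∩ C0) := by
    refine real_congr_of_sure hG1 fun ω hω => ?_
    simp only [Set.mem_inter_iff]
    rw [bridge_conn_lr L hsL (hωG ω hω) hs1 hbL, bridge_conn_lr L hsL (hωG ω hω) hs1 hcL]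
    exact ⟨fun h => ⟨h.1.2, h.2.2⟩, fun h => ⟨⟨⟨hs1, hs1, SimpleGraph.Reachable.refl _⟩, h.1⟩,
      ⟨⟨hs1, hs1, SimpleGraph.Reachable.refl _⟩, h.2⟩⟩⟩
  have m0abc : (prodBernoulli w0).real (openConn s a ∩ openConn s b ∩ openConn s c) = (prodBernoulli w0).real T * (prodBernoulli w0).real (B0 ∩ C0) := by
    rw [← indep hdT (hdB0.inter hdC0)]
    refine real_congr_of_sure hG1 fun ω hω => ?_
    simp only [Set.mem_inter_iff]
    rw [bridge_conn_ll L hsL (hωG ω hω) hs1 ha1, bridge_conn_lr L hsL (hωG ω hω) hs1 hbL,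
      bridge_conn_lr L hsL (hωG ω hω) hs1 hcL]
    exact ⟨fun h => ⟨h.1.1, h.1.2.2, h.2.2⟩, fun h => ⟨⟨h.1, ⟨hs1, hs1, SimpleGraph.Reachable.refl _⟩, h.2.1⟩,
      ⟨hs1, hs1, SimpleGraph.Reachable.refl _⟩, h.2.2⟩⟩
  -- (4) the moments under `w1`: lift through `insert e`, then decompose into disjoint independent pieces
  have lift : ∀ A : Set (BondConfig (Fin n)), (prodBernoulli w1).real A = (prodBernoulli w0).real ((fun ω : BondConfig (Fin n) => insert e ω) ⁻¹' A) :=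
    fun A => tieLiftOne_real_one_eq w e A
  -- pointwise forms of the lifted events on `G`
  have liftA : ∀ ω ∈ G, (insert e ω ∈ openConn s a ↔ ω ∈ T ∨ (ω ∈ F ∧ ω ∉ T ∧ ω ∈ P')) := by
    intro ω hω
    rw [bridge_lift_near L hsL huL hvL haL (hωG ω hω)]
    constructor
    · rintro (h | ⟨hP, hF'⟩)
      · exact Or.inl h
      · by_cases hT' : ω ∈ T
        · exact Or.inl hT'
        · exact Or.inr ⟨hF', hT', hP⟩
    · rintro (h | ⟨hF', -, hP⟩)
      · exact Or.inl h
      · exact Or.inr ⟨hP, hF'⟩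
  have liftFar : ∀ t : Fin n, t ∉ L → ∀ ω ∈ G, (insert e ω ∈ openConn s t ↔
      ω ∈ openConnIn Lᶜ s t ∨ (ω ∈ S ∧ ω ∈ (openConnIn Lᶜ v t \ openConnIn Lᶜ s t))) := by
    intro t htL ω hω
    rw [bridge_lift_far L hsL huL hvL htL (hωG ω hω)]
    constructor
    · rintro (h | ⟨hS', hR⟩)
      · exact Or.inl h
      · by_cases hB : ω ∈ openConnIn Lᶜ s t
        · exact Or.inl hB
        · exact Or.inr ⟨hS', hR, hB⟩
    · rintro (h | ⟨hS', hR, -⟩)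
      · exact Or.inl h
      · exact Or.inr ⟨hS', hR⟩
  have liftB : ∀ ω ∈ G, (insert e ω ∈ openConn s b ↔ ω ∈ B0 ∨ (ω ∈ S ∧ ω ∈ (openConnIn Lᶜ v b \ B0))) := liftFar b hbL
  have liftC : ∀ ω ∈ G, (insert e ω ∈ openConn s c ↔ ω ∈ C0 ∨ (ω ∈ S ∧ ω ∈ (openConnIn Lᶜ v c \ C0))) := liftFar c hcL
  -- disjoint-union bookkeeping
  have hunion : ∀ {X Y : Set (BondConfig (Fin n))}, Disjoint X Y → (prodBernoulli w0).real (X ∪ Y) = (prodBernoulli w0).real X + (prodBernoulli w0).real Y :=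
    fun hXY => measureReal_union hXY (hm _)
  -- m1a = τ + α σ'
  have m1a : (prodBernoulli w1).real (openConn s a) = (prodBernoulli w0).real T + (prodBernoulli w0).real (F \ T) * (prodBernoulli w0).real P' := by
    rw [lift, ← indep (hdiff hdF hdT) hdP', ← hunion]
    · refine real_congr_of_sure hG1 fun ω hω => ?_
      simp only [Set.mem_preimage]
      rw [liftA ω hω]
      simp only [Set.mem_union, Set.mem_inter_iff, Set.mem_sdiff]
      tauto
    · exact Set.disjoint_left.2 fun ω hT' hx => hx.1.2 hT'
  -- m1b = mb + σ db
  have m1b : (prodBernoulli w1).real (openConn s b) = (prodBernoulli w0).real B0 + (prodBernoulli w0).real S * (prodBernoulli w0).real (openConnIn Lᶜ v b \ B0) := by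
    rw [lift, ← indep hdS hdRb, ← hunion]
    · refine real_congr_of_sure hG1 fun ω hω => ?_
      simp only [Set.mem_preimage]
      rw [liftB ω hω]
      simp only [Set.mem_union, Set.mem_inter_iff]
    · exact Set.disjoint_left.2 fun ω hB hx => hx.2.2 hB
  have m1c : (prodBernoulli w1).real (openConn s c) = (prodBernoulli w0).real C0 + (prodBernoulli w0).real S * (prodBernoulli w0).real (openConnIn Lᶜ v c \ C0) := by
    rw [lift, ← indep hdS hdRc, ← hunion]
    · refine real_congr_of_sure hG1 fun ω hω => ?_
      simp only [Set.mem_preimage]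
      rw [liftC ω hω]
      simp only [Set.mem_union, Set.mem_inter_iff]
    · exact Set.disjoint_left.2 fun ω hC hx => hx.2.2 hC
  -- m1ab = τ mb + P(T∩S) db + α yb
  have m1ab : (prodBernoulli w1).real (openConn s a ∩ openConn s b) =
      (prodBernoulli w0).real T * (prodBernoulli w0).real B0 + (prodBernoulli w0).real (T ∩ S) * (prodBernoulli w0).real (openConnIn Lᶜ v b \ B0) + (prodBernoulli w0).real (F \ T) * (prodBernoulli w0).real (P' ∩ B0) := by
    rw [lift, ← indep hdT hdB0, ← indep (hdT.inter hdS) hdRb, ← indep (hdiff hdF hdT) (hdP'.inter hdB0),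
      ← hunion, ← hunion]
    · refine real_congr_of_sure hG1 fun ω hω => ?_
      simp only [Set.preimage_inter, Set.mem_inter_iff, Set.mem_preimage]
      rw [liftA ω hω, liftB ω hω]
      simp only [Set.mem_union, Set.mem_inter_iff, Set.mem_sdiff]
      constructor
      · rintro ⟨hA | ⟨hF', hnT, hP⟩, hB | ⟨hS', hR⟩⟩
        · exact Or.inl (Or.inl ⟨hA, hB⟩)
        · exact Or.inl (Or.inr ⟨⟨hA, hS'⟩, hR⟩)
        · exact Or.inr ⟨⟨hF', hnT⟩, hP, hB⟩
        · exact absurd (hSF_T ω hS' hF') hnT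
      · rintro ((⟨hA, hB⟩ | ⟨⟨hA, hS'⟩, hR⟩) | ⟨⟨hF', hnT⟩, hP, hB⟩)
        · exact ⟨Or.inl hA, Or.inl hB⟩
        · exact ⟨Or.inl hA, Or.inr ⟨hS', hR⟩⟩
        · exact ⟨Or.inr ⟨hF', hnT, hP⟩, Or.inl hB⟩
    · exact Set.disjoint_left.2 fun ω h1 h2 => by
        rcases h1 with ⟨hA, -⟩ | ⟨⟨hA, -⟩, -⟩ <;> exact h2.1.2 hA
    · exact Set.disjoint_left.2 fun ω h1 h2 => h2.2.2 h1.2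
  have m1ac : (prodBernoulli w1).real (openConn s a ∩ openConn s c) =
      (prodBernoulli w0).real T * (prodBernoulli w0).real C0 + (prodBernoulli w0).real (T ∩ S) * (prodBernoulli w0).real (openConnIn Lᶜ v c \ C0) + (prodBernoulli w0).real (F \ T) * (prodBernoulli w0).real (P' ∩ C0) := by
    rw [lift, ← indep hdT hdC0, ← indep (hdT.inter hdS) hdRc, ← indep (hdiff hdF hdT) (hdP'.inter hdC0),
      ← hunion, ← hunion]
    · refine real_congr_of_sure hG1 fun ω hω => ?_
      simp only [Set.preimage_inter, Set.mem_inter_iff, Set.mem_preimage]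
      rw [liftA ω hω, liftC ω hω]
      simp only [Set.mem_union, Set.mem_inter_iff, Set.mem_sdiff]
      constructor
      · rintro ⟨hA | ⟨hF', hnT, hP⟩, hC | ⟨hS', hR⟩⟩
        · exact Or.inl (Or.inl ⟨hA, hC⟩)
        · exact Or.inl (Or.inr ⟨⟨hA, hS'⟩, hR⟩)
        · exact Or.inr ⟨⟨hF', hnT⟩, hP, hC⟩
        · exact absurd (hSF_T ω hS' hF') hnT
      · rintro ((⟨hA, hC⟩ | ⟨⟨hA, hS'⟩, hR⟩) | ⟨⟨hF', hnT⟩, hP, hC⟩)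
        · exact ⟨Or.inl hA, Or.inl hC⟩
        · exact ⟨Or.inl hA, Or.inr ⟨hS', hR⟩⟩
        · exact ⟨Or.inr ⟨hF', hnT, hP⟩, Or.inl hC⟩
    · exact Set.disjoint_left.2 fun ω h1 h2 => by
        rcases h1 with ⟨hA, -⟩ | ⟨⟨hA, -⟩, -⟩ <;> exact h2.1.2 hA
    · exact Set.disjoint_left.2 fun ω h1 h2 => h2.2.2 h1.2
  -- m1bc = mbc + σ (ξc + ξb + dbc)
  have m1bc : (prodBernoulli w1).real (openConn s b ∩ openConn s c) =
      (prodBernoulli w0).real (B0 ∩ C0) + (prodBernoulli w0).real S * (prodBernoulli w0).real (B0 ∩ (openConnIn Lᶜ v c \ C0)) + (prodBernoulli w0).real S * (prodBernoulli w0).real ((openConnIn Lᶜ v b \ B0) ∩ C0)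
        + (prodBernoulli w0).real S * (prodBernoulli w0).real ((openConnIn Lᶜ v b \ B0) ∩ (openConnIn Lᶜ v c \ C0)) := by
    rw [lift, ← indep hdS (hdB0.inter hdRc), ← indep hdS (hdRb.inter hdC0), ← indep hdS (hdRb.inter hdRc),
      ← hunion, ← hunion, ← hunion]
    · refine real_congr_of_sure hG1 fun ω hω => ?_
      simp only [Set.preimage_inter, Set.mem_inter_iff, Set.mem_preimage]
      rw [liftB ω hω, liftC ω hω]
      simp only [Set.mem_union, Set.mem_inter_iff]
      constructor
      · rintro ⟨hB | ⟨hS', hRb'⟩, hC | ⟨hS'', hRc'⟩⟩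
        · exact Or.inl (Or.inl (Or.inl ⟨hB, hC⟩))
        · exact Or.inl (Or.inl (Or.inr ⟨hS'', hB, hRc'⟩))
        · exact Or.inl (Or.inr ⟨hS', hRb', hC⟩)
        · exact Or.inr ⟨hS', hRb', hRc'⟩
      · rintro (((⟨hB, hC⟩ | ⟨hS', hB, hRc'⟩) | ⟨hS', hRb', hC⟩) | ⟨hS', hRb', hRc'⟩)
        · exact ⟨Or.inl hB, Or.inl hC⟩
        · exact ⟨Or.inl hB, Or.inr ⟨hS', hRc'⟩⟩
        · exact ⟨Or.inr ⟨hS', hRb'⟩, Or.inl hC⟩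
        · exact ⟨Or.inr ⟨hS', hRb'⟩, Or.inr ⟨hS', hRc'⟩⟩
    · exact Set.disjoint_left.2 fun ω h1 h2 => by
        rcases h1 with (⟨hB, -⟩ | ⟨-, hB, -⟩) | ⟨-, -, hC⟩
        · exact h2.2.1.2 hB
        · exact h2.2.1.2 hB
        · exact h2.2.2.2 hC
    · exact Set.disjoint_left.2 fun ω h1 h2 => by
        rcases h1 with ⟨hB, -⟩ | ⟨-, hB, -⟩ <;> exact h2.2.1.2 hB
    · exact Set.disjoint_left.2 fun ω h1 h2 => h2.2.2.2 h1.2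
  -- (5) the four classical inequalities
  have hup : ∀ (X : Set (Fin n)) (x y : Fin n), IsUpperSet (openConnIn X x y : Set (BondConfig (Fin n))) :=
    fun X x y => isUpperSet_openConnIn X x y
  have hHarris : ∀ {A B : Set (BondConfig (Fin n))}, IsUpperSet A → IsUpperSet B →
      (prodBernoulli w0).real A * (prodBernoulli w0).real B ≤ (prodBernoulli w0).real (A ∩ B) := fun hA hB => prodBernoulli_harris w0 hA hB (hm _) (hm _)
  have H1b : (prodBernoulli w0).real P' * (prodBernoulli w0).real B0 ≤ (prodBernoulli w0).real (P' ∩ B0) := hHarris (hup _ _ _) (hup _ _ _)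
  have H1c : (prodBernoulli w0).real P' * (prodBernoulli w0).real C0 ≤ (prodBernoulli w0).real (P' ∩ C0) := hHarris (hup _ _ _) (hup _ _ _)
  have H2 : (prodBernoulli w0).real T * (prodBernoulli w0).real S ≤ (prodBernoulli w0).real (T ∩ S) := hHarris (hup _ _ _) (hup _ _ _)
  have hSF : S ∩ F = F ∩ T := by
    ext ω
    simp only [Set.mem_inter_iff]
    exact ⟨fun h => ⟨h.2, hSF_T ω h.1 h.2⟩, fun h => ⟨hFT_S ω h.1 h.2, h.1⟩⟩
  have hFsplit : (prodBernoulli w0).real F = (prodBernoulli w0).real (F ∩ T) + (prodBernoulli w0).real (F \ T) := (measureReal_inter_add_sdiff (hm T)).symm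
  have H4 : (prodBernoulli w0).real S * ((prodBernoulli w0).real (F \ T) + (prodBernoulli w0).real (F ∩ T)) ≤ (prodBernoulli w0).real (F ∩ T) := by
    have h := hHarris (hup _ _ _ : IsUpperSet S) (hup _ _ _ : IsUpperSet F)
    rw [hSF, hFsplit] at h
    linarith
  have hK : (prodBernoulli w0).real (F ∩ T) ≤ (prodBernoulli w0).real (T ∩ S) :=
    measureReal_mono fun ω h => ⟨h.2, hFT_S ω h.1 h.2⟩
  -- (H3): van den Berg–Kahn Theorem 1.1 at `v`, avoiding `s`, under `w0`
  have hvbs : ∀ ω ∈ G, ∀ t : Fin n, t ∈ Lᶜ →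
      (ω ∈ openConnIn Lᶜ v t \ openConnIn Lᶜ s t ↔ ω ∈ openConn v t ∩ (openConn v s)ᶜ) := by
    intro ω hω t ht
    rw [Set.mem_sdiff, Set.mem_inter_iff, Set.mem_compl_iff, bridge_conn_rr L hsL (hωG ω hω) hvL ht,
      bridge_conn_rr L hsL (hωG ω hω) hvL hsL]
    constructor
    · rintro ⟨hR, hnB⟩
      exact ⟨hR, fun hvs => hnB (PlanarDuality.openConnIn_trans (openConnIn_symm' hvs) hR)⟩
    · rintro ⟨hR, hnvs⟩
      exact ⟨hR, fun hB => hnvs (PlanarDuality.openConnIn_trans hR (openConnIn_symm' hB))⟩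
  have edb : (prodBernoulli w0).real (openConnIn Lᶜ v b \ B0) = (prodBernoulli w0).real (openConn v b ∩ (openConn v s)ᶜ) :=
    real_congr_of_sure hG1 fun ω hω => hvbs ω hω b hbL
  have edc : (prodBernoulli w0).real (openConnIn Lᶜ v c \ C0) = (prodBernoulli w0).real (openConn v c ∩ (openConn v s)ᶜ) :=
    real_congr_of_sure hG1 fun ω hω => hvbs ω hω c hcL
  have edbc : (prodBernoulli w0).real ((openConnIn Lᶜ v b \ B0) ∩ (openConnIn Lᶜ v c \ C0)) = (prodBernoulli w0).real (openConn v b ∩ openConn v c ∩ (openConn v s)ᶜ) :=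
    real_congr_of_sure hG1 fun ω hω => by
      rw [Set.mem_inter_iff, hvbs ω hω b hbL, hvbs ω hω c hcL]
      simp only [Set.mem_inter_iff, Set.mem_compl_iff]
      tauto
  have H3 : (prodBernoulli w0).real (openConnIn Lᶜ v b \ B0) * (prodBernoulli w0).real (openConnIn Lᶜ v c \ C0) ≤ (prodBernoulli w0).real ((openConnIn Lᶜ v b \ B0) ∩ (openConnIn Lᶜ v c \ C0)) := by
    have h := Literature.Probability.Percolation.BergKahn.bergKahn_thm_1_1 w0 v b c s
    rw [edb, edc, edbc]
    refine h.trans ?_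
    have h1 : (prodBernoulli w0).real (openConn v s : Set (BondConfig (Fin n)))ᶜ ≤ 1 := measureReal_le_one
    have h0 : 0 ≤ (prodBernoulli w0).real (openConn v b ∩ openConn v c ∩ (openConn v s)ᶜ) := measureReal_nonneg
    nlinarith
  -- sign conditions
  have hσ'1 : (prodBernoulli w0).real P' ≤ 1 := measureReal_le_one
  have hp0 : (0 : ℝ) ≤ w e := (w e).2.1
  have hp1 : (w e : ℝ) ≤ 1 := (w e).2.2
  -- (6) one-bond decomposition of the seven moments of `P_w`
  have ob : ∀ A : Set (BondConfig (Fin n)),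
      (prodBernoulli w).real A = (1 - (w e : ℝ)) * (prodBernoulli w0).real A + (w e : ℝ) * (prodBernoulli w1).real A := by
    intro A
    have hA : DeterminedBy A (↑(Finset.univ : Finset (Sym2 (Fin n))) : Set (Sym2 (Fin n))) := by
      rw [determinedBy_iff]
      intro ω ω' h
      rw [Finset.coe_univ, Set.inter_univ, Set.inter_univ] at h
      rw [h]
    exact prodBernoulli_real_oneBond hA w (Finset.mem_univ e)
  -- (7) assemble
  have E0 : sahiE3 (prodBernoulli w0) (openConn s a) (openConn s b) (openConn s c) =
      (prodBernoulli w0).real T * ((prodBernoulli w0).real (B0 ∩ C0) - (prodBernoulli w0).real B0 * (prodBernoulli w0).real C0) := by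
    rw [sahiE3_def, m0abc, m0a, m0b, m0c, m0bc, m0ac, m0ab]; ring
  have E1 : sahiE3 (prodBernoulli w1) (openConn s a) (openConn s b) (openConn s c) =
      2 * (prodBernoulli w1).real (openConn s a ∩ openConn s b ∩ openConn s c)
        + ((prodBernoulli w0).real T + (prodBernoulli w0).real (F \ T) * (prodBernoulli w0).real P') * ((prodBernoulli w0).real B0 + (prodBernoulli w0).real S * (prodBernoulli w0).real (openConnIn Lᶜ v b \ B0))
            * ((prodBernoulli w0).real C0 + (prodBernoulli w0).real S * (prodBernoulli w0).real (openConnIn Lᶜ v c \ C0))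
        - (((prodBernoulli w0).real T + (prodBernoulli w0).real (F \ T) * (prodBernoulli w0).real P')
              * ((prodBernoulli w0).real (B0 ∩ C0) + (prodBernoulli w0).real S * ((prodBernoulli w0).real ((openConnIn Lᶜ v b \ B0) ∩ C0) + (prodBernoulli w0).real (B0 ∩ (openConnIn Lᶜ v c \ C0)) + (prodBernoulli w0).real ((openConnIn Lᶜ v b \ B0) ∩ (openConnIn Lᶜ v c \ C0))))
            + ((prodBernoulli w0).real B0 + (prodBernoulli w0).real S * (prodBernoulli w0).real (openConnIn Lᶜ v b \ B0))
              * ((prodBernoulli w0).real T * (prodBernoulli w0).real C0 + ((prodBernoulli w0).real (T ∩ S) * (prodBernoulli w0).real (openConnIn Lᶜ v c \ C0) + (prodBernoulli w0).real (F \ T) * (prodBernoulli w0).real (P' ∩ C0)))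
            + ((prodBernoulli w0).real C0 + (prodBernoulli w0).real S * (prodBernoulli w0).real (openConnIn Lᶜ v c \ C0))
              * ((prodBernoulli w0).real T * (prodBernoulli w0).real B0 + ((prodBernoulli w0).real (T ∩ S) * (prodBernoulli w0).real (openConnIn Lᶜ v b \ B0) + (prodBernoulli w0).real (F \ T) * (prodBernoulli w0).real (P' ∩ B0)))) := by
    rw [sahiE3_def, m1a, m1b, m1c, m1bc, m1ac, m1ab]; ring
  have Ew : sahiE3 (prodBernoulli w) (openConn s a) (openConn s b) (openConn s c) =
      2 * ((prodBernoulli w0).real T * (prodBernoulli w0).real (B0 ∩ C0)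
            + (w e : ℝ) * ((prodBernoulli w1).real (openConn s a ∩ openConn s b ∩ openConn s c) - (prodBernoulli w0).real T * (prodBernoulli w0).real (B0 ∩ C0)))
        + ((prodBernoulli w0).real T + (w e : ℝ) * ((prodBernoulli w0).real (F \ T) * (prodBernoulli w0).real P'))
            * ((prodBernoulli w0).real B0 + (w e : ℝ) * ((prodBernoulli w0).real S * (prodBernoulli w0).real (openConnIn Lᶜ v b \ B0)))
            * ((prodBernoulli w0).real C0 + (w e : ℝ) * ((prodBernoulli w0).real S * (prodBernoulli w0).real (openConnIn Lᶜ v c \ C0)))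
        - (((prodBernoulli w0).real T + (w e : ℝ) * ((prodBernoulli w0).real (F \ T) * (prodBernoulli w0).real P'))
              * ((prodBernoulli w0).real (B0 ∩ C0)
                  + (w e : ℝ) * ((prodBernoulli w0).real S * ((prodBernoulli w0).real ((openConnIn Lᶜ v b \ B0) ∩ C0) + (prodBernoulli w0).real (B0 ∩ (openConnIn Lᶜ v c \ C0)) + (prodBernoulli w0).real ((openConnIn Lᶜ v b \ B0) ∩ (openConnIn Lᶜ v c \ C0)))))
            + ((prodBernoulli w0).real B0 + (w e : ℝ) * ((prodBernoulli w0).real S * (prodBernoulli w0).real (openConnIn Lᶜ v b \ B0)))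
              * ((prodBernoulli w0).real T * (prodBernoulli w0).real C0
                  + (w e : ℝ) * ((prodBernoulli w0).real (T ∩ S) * (prodBernoulli w0).real (openConnIn Lᶜ v c \ C0) + (prodBernoulli w0).real (F \ T) * (prodBernoulli w0).real (P' ∩ C0)))
            + ((prodBernoulli w0).real C0 + (w e : ℝ) * ((prodBernoulli w0).real S * (prodBernoulli w0).real (openConnIn Lᶜ v c \ C0)))
              * ((prodBernoulli w0).real T * (prodBernoulli w0).real B0
                  + (w e : ℝ) * ((prodBernoulli w0).real (T ∩ S) * (prodBernoulli w0).real (openConnIn Lᶜ v b \ B0) + (prodBernoulli w0).real (F \ T) * (prodBernoulli w0).real (P' ∩ B0)))) := by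
    rw [sahiE3_def, ob, ob, ob, ob, ob, ob, ob, m0abc, m0a, m0b, m0c, m0bc, m0ac, m0ab,
      m1a, m1b, m1c, m1bc, m1ac, m1ab]
    ring
  rw [E0, E1, Ew]
  exact bridgeChord_poly (w e) ((prodBernoulli w0).real T) ((prodBernoulli w0).real B0) ((prodBernoulli w0).real C0) ((prodBernoulli w0).real (B0 ∩ C0))
    ((prodBernoulli w1).real (openConn s a ∩ openConn s b ∩ openConn s c)) ((prodBernoulli w0).real (F \ T)) ((prodBernoulli w0).real (F ∩ T)) ((prodBernoulli w0).real S)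
    ((prodBernoulli w0).real (T ∩ S)) ((prodBernoulli w0).real P') ((prodBernoulli w0).real (openConnIn Lᶜ v b \ B0)) ((prodBernoulli w0).real (openConnIn Lᶜ v c \ C0)) ((prodBernoulli w0).real ((openConnIn Lᶜ v b \ B0) ∩ (openConnIn Lᶜ v c \ C0))) ((prodBernoulli w0).real ((openConnIn Lᶜ v b \ B0) ∩ C0))
    ((prodBernoulli w0).real (B0 ∩ (openConnIn Lᶜ v c \ C0))) ((prodBernoulli w0).real (P' ∩ B0)) ((prodBernoulli w0).real (P' ∩ C0)) hp0 hp1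
    measureReal_nonneg measureReal_nonneg measureReal_nonneg measureReal_nonneg hσ'1 hK
    measureReal_nonneg measureReal_nonneg measureReal_nonneg measureReal_nonneg H1b H1c H2 H3 H4

end IncStar

end Summit.CriticalPhenomena.PercolationContinuityZ3.Theorems
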